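import Summits.QuantumAdvantage.QuantumAdvantage.Theses.SelmerBand
import Summits.QuantumAdvantage.QuantumAdvantage.Theorems.ArithStatLadderIqThreeMemBQPStubGuardedOr
import HarnessLib

/-!
# Line `birth` — BC3 skeleton for the crux `SelmerMemBQP` (stmt-QuantumAdvantage-17067)

Route `SelmerBand` (route-QuantumAdvantage-SelmerBand; deciding theorem
`closes (hBand : PriorBand) (hMem : SelmerMemBQP) (hHyp : BeyondConstant) : QuantumAdvantage`),
crux #3 (rank 3, difficulty XL, "open-grade as typed" per the route-review refuter):

  `SelmerMemBQP := (let P AB := #Sel₂(E_{A,B}) ≤ 2; let enc AB := encodeNat (encode AB);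
     enc '' {AB | IsInHeightFamily AB ∧ P AB}) ∈ BQP`

— the non-parity Selmer bit of the height-ordered family `E_{A,B} : y² = x³ + Ax + B` is decided with
bounded error by a `P`-uniform oracle-free Clifford+T family (tree model
`Literature.Computability.Cryptography.BQP`).

## The line: cut the `2`-descent by the rational `2`-torsion of `E_{A,B}` — the seam where GRH enters

For `(A, B)` in the family the monic integer cubic `f = x³ + Ax + B` is squarefree, so it has `0`, `1`
or `3` INTEGER roots (`#E(ℚ)[2] = 1, 2, 4`), and the `2`-descent algebra `K_f = ℚ[x]/(f)` is a cubic
field, `ℚ × ℚ(√d)` (`d = −3r² − 4A`, `r` the root), or `ℚ³`.  By Cassels / Schaefer–Stoll,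
`Sel₂(E/ℚ) ≅ {θ ∈ ker(N : K_f(S,2) → ℚ(S,2)) : θ_v ∈ δ_v(E(ℚ_v)/2) for v ∈ S ∪ {∞}}`, `S = {p ∣ 2Δ}`,
so a decision procedure needs (i) the factorisation of `Δ` (Shor, tree theorem `factoring_mem_FBQP_holds`),
(ii) an `𝔽₂`-basis of `K_f(S,2)` — i.e. `S`-units mod squares and `Cl_S[2]` of the FIELD FACTORS of
`K_f` — and (iii) polynomial-time local images and linear algebra.  Step (ii) is trivial for `ℚ³`,
quantum-polynomial and plausibly GRH-FREE for a quadratic factor (relations among the GIVEN prime ideals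
above `S` by an abelian hidden-subgroup computation, `Cl[2]` by genus theory, principal-ideal generators by
Hallgren's algorithms), and quantum-polynomial only UNDER GRH for a cubic field (Hallgren 2005 /
Biasse–Song certify a generating set of `Cl(K)` through Bach's bound) — the obstruction recorded on the
item by the grounder and the route-review refuter.  The skeleton therefore splits the witness language by
`2`-torsion case into three PROMISE problems (promise = "a canonical code of a family member"), adds the
family-recognition language as the GUARD (power-freeness `¬∃ p, p⁴ ∣ A ∧ p⁶ ∣ B` is not known to be in `P`
but is in `BQP` via Shor), and glues with the tree's LANDED generic closure theorem
`Theorems.ArithStatLadder.IqThreeMemBQP.stub_guardedOr`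
(`G ∈ BQP → Q₁ Q₂ Q₃ ∈ PromiseBQP → (members ⊆ G ∩ ⋃ Qᵢ.yes) → (non-members ⊆ Gᶜ ∪ ⋂ Qᵢ.no) → L ∈ BQP`,
exception set `E = ∅`).

* `stub_family` (S1, QUANTUM front end, size M–L, GRH-free): the guard
  `{enc AB | IsInHeightFamily AB} ∈ BQP` — canonical-code check (`encodeNat ∘ decodeNat`, `Encodable`
  round trip on `ℤ × ℤ`), `4A³ + 27B² ≠ 0`, and `¬∃ p prime, p⁴ ∣ A ∧ p⁶ ∣ B` read off the prime
  factorisation of `gcd(A, B)` (Shor: `factoring_mem_FBQP_holds`; wrap `isQSolvable_classicalWrap_holds`,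
  decision `mem_BQP_of_isQSolvable_bit`).  Why it might fail: only as typed (it is a theorem in print).
* `stub_split` (S2, full rational `2`-torsion, size L, GRH-free): on the promise, decide
  "three integer roots ∧ #Sel₂ ≤ 2" vs its negation: integer roots of `f` in `P` (divisors not needed:
  numerical root isolation + check, or LLL factoring over `ℚ`), complete `2`-descent over `K_f = ℚ³`
  (Silverman AEC X.1.4; `K_f(S,2) = ℚ(S,2)³` explicit from `S`), local images at `v ∈ S ∪ {∞}` by bounded
  `p`-adic computation, `𝔽₂`-linear algebra; the only quantum step is Shor for `S`.  Leans on the tree's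
  descent files (`KramerDescent*`, `Selmer.lean`: `exists_kummerMap_holds`, `finite_selmerGroup_holds`).
  Why it might fail: not mathematically; the identification of the tree's cohomological `selmerGroup 2`
  with the explicit descent group is XL formalisation (shared with S3/S4).
* `stub_oneRoot` (S3, one rational `2`-torsion point, size XL, plausibly GRH-free): `K_f = ℚ × F`,
  `F = ℚ(√d)`; `F(S,2)` from (a) the relation lattice of the prime ideals of `F` above `S` in `Cl(F)` —
  an abelian HSP over `ℤ^k` with GIVEN generators (imaginary `F`: unique reduced forms; real `F`:
  Hallgren's period lattice over `ℝ × ℤ^k`), (b) generators of the resulting principal ideals (reduction /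
  Hallgren's PIP), (c) `Cl_S(F)[2]` from genus theory (ambiguous classes from the factorisation of `d`)
  and square roots in `Cl(F)` (Gauss–Shanks; Lagarias 1980, polynomial given the factorisation); then
  descent as in S2.  Why it might fail: the GRH-freeness of (a)–(b) for REAL quadratic `F` as a uniform
  circuit family is printed only in pieces (Hallgren 2002/2005); a careless reading re-imports Bach bounds.
* `stub_irreducible` (S4, no rational `2`-torsion, size XL / OPEN as typed): `K_f` a cubic field;
  `O_{K,S}^×/2` and `Cl_S(K)[2]` by Hallgren 2005 (constant degree: units, PIP, class group) /
  Eisenträger–Hallgren–Kitaev–Song 2014 / Biasse–Song 2016 (`S`-units) — whose class-group half certifies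
  a GENERATING SET only via Bach's bound (GRH).  GRH-free generation of `Cl(K)[2]` for general cubic `K`
  is open (route LinnikCubicClassGroups' line; Deuring–Heilbronn leaves one exceptional character); the
  crux idea `integers-not-primes` attached to this item (Shor-sampled INTEGRAL ideals equidistribute in
  `Cl(K)` by geometry of numbers, Debaene arXiv:1611.10103 Cor. 1; cubic fields are never "dark") is a
  plan for exactly this stub.  Why it might fail: unconditional as typed — this stub carries the whole
  open-grade content of the crux; under `GrandRiemannHypothesisGL` it is provable from print.
* Composition `SelmerMemBQP_of` (sorry-free, kernel-checked): `stub_guardedOr` with `G` = the family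
  language, `(Q₁, Q₂, Q₃)` = (split, one root, irreducible), `E = ∅`; a member `enc AB` (family ∧
  `#Sel₂ ≤ 2`) lies in `G` and in the yes-part of its `2`-torsion case (pure logic: `C₃ ∨ (C₁ ∧ ¬C₃) ∨ ¬∃root`);
  a non-member either lies outside `G` or is `enc AB` with `AB` in the family and `#Sel₂ > 2`, hence in
  all three no-parts `{family ∧ ¬(Cᵢ ∧ P)}`.  No injectivity of `enc` is needed.

Hardest stub: `stub_irreducible` (open-grade as typed: GRH-free class-group generation for cubic fields).
De-risking order for a lead: S1 (M–L, all ingredients in the tree) → S2 → S3 → S4.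

Disproof used: none exists for this crux (`ledger crux ls stmt-QuantumAdvantage-17067`: "(no workfiles
yet)" — no `Disproof.lean`, no `Lines/`, no `Theorems/…/SelmerMemBQP/Negative/` lemmas; 2026-08-17).
Negatives index (`ledger negatives --problem QuantumAdvantage`, 2026-08-17: 6 refuted statements —
RegulatorThird 15712, ShorLocallyDark 8592, CubicStability 2202, SpinorFlattening 1244, KummerSector 1615,
SeparableFrames 9863): none concerns Selmer groups, the height family, or membership of an arithmetic
language in `BQP`/`PromiseBQP`; no stub restates one.
Dead lines: none recorded for this crux.
Barriers: none of `Literature.Barriers.QuantumAdvantage.*` bites an INCLUSION `L ∈ BQP` proved by an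
explicit uniform family (SeparationPrerequisites is confined to the route's hypothesis-type crux
BeyondConstant; RandomOracleMethod / TotalFunctionSpeedupLimit are oracle/query-model statements — the
input `(A, B)` is white-box).
BC3 record (registrar's folder `bc/`): `lean check bc/SelmerMemBQP_birth.lean` rc 0, errors 0, sorries
4 = stubs 4 (the four `stub_*` declarations; zero elsewhere — `SelmerMemBQP_of` and the `example` are
sorry-free); probes `Sᵢ → SelmerMemBQP` and `Sᵢ → QuantumAdvantage` by `first | exact? | simpa | aesop`
and by `first | exact? | simpa [Sᵢ, target] | (unfold …; simpa) | aesop` FAIL for i = 1…4 (8 files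
`bc/stubN_probe_{crux,summit}.lean`, statements inlined, rc 1 "unsolved goals ⊢ SelmerMemBQP /
⊢ QuantumAdvantage", aesop exhaustive search failed); dedup `example : Sᵢ := by exact?` FAILS for all four
(`bc/stubs_dedup_probe.lean`).

## References

* J. W. S. Cassels, *Second descents for elliptic curves*, J. reine angew. Math. 494 (1998) 101–127, §2.
* E. F. Schaefer, M. Stoll, *How to do a p-descent on an elliptic curve*, Trans. AMS 356 (2004) 1209–1231
  [doi:10.1090/S0002-9947-03-03366-X].
* D. Simon, *Computing the rank of elliptic curves over number fields*, LMS J. Comput. Math. 5 (2002)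
  [doi:10.1112/S1461157002000688].
* J. H. Silverman, *The Arithmetic of Elliptic Curves*, GTM 106, X.1 (complete 2-descent, Prop. X.1.4), X.4.
* S. Hallgren, *Fast quantum algorithms for computing the unit group and class group of a number field*,
  STOC 2005 [doi:10.1145/1060590.1060660]; *Polynomial-time quantum algorithms for Pell's equation and the
  principal ideal problem*, J. ACM 54 (2007) [doi:10.1145/1206035.1206039].
* K. Eisenträger, S. Hallgren, A. Kitaev, F. Song, *A quantum algorithm for computing the unit group of an
  arbitrary degree number field*, STOC 2014; J.-F. Biasse, F. Song, SODA 2016 and arXiv:2510.02280.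
* J. C. Lagarias, *Worst-case complexity bounds for algorithms in the theory of integral quadratic forms*,
  J. Algorithms 1 (1980) 142–186 (genus characters and square roots in class groups, given factorisations).
* P. W. Shor, SIAM J. Comput. 26 (1997) §5 (tree: `factoring_mem_FBQP_holds`).
* M. Bhargava, A. Shankar, Ann. of Math. 181 (2015) = arXiv:1006.1002, §1 (the family `E_{A,B}`).
* K. Debaene, arXiv:1611.10103, Cor. 1 (explicit equidistribution of integral ideals in `Cl(K)`; the
  `integers-not-primes` idea for S4).
-/

set_option linter.dupNamespace false
set_option linter.unusedVariables false

noncomputable section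

namespace Summit.QuantumAdvantage.QuantumAdvantage.Cruxes.SelmerMemBQP.Birth

open _root_.Computability Literature.Computability.Complexity Literature.Computability.Cryptography
open Literature.NumberTheory.EllipticCurves (shortWeierstrass IsInHeightFamily)
open Summit.QuantumAdvantage.QuantumAdvantage.Theses.SelmerBand (SelmerMemBQP)

/-! ### The stubs (registered; `sorry` lives only here) -/

/-- **S1 `stub_family`** (QUANTUM front end; GRH-free; M–L).  The Bhargava–Shankar height family is
recognisable in `BQP`: the language of canonical codes `encodeNat (encode (A, B))` of pairs with
`4A³ + 27B² ≠ 0` and no prime `p` with `p⁴ ∣ A ∧ p⁶ ∣ B`.  Canonicity and the discriminant are `P`-time;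
the power condition is read off the prime factorisation of `gcd(A, B)` (`p⁴ ∣ A ∧ p⁶ ∣ B ⇒ p ∣ gcd(A,B)`),
supplied by Shor (`factoring_mem_FBQP_holds`) inside a classical wrap (`isQSolvable_classicalWrap_holds`,
`mem_BQP_of_isQSolvable_bit`).  Power-freeness is not known to be in `P`, so the quantum step is genuine.
[cite: Shor1997, §5] [cite: BhargavaShankarAnnals2015, §1] -/
theorem stub_family :
    (fun AB : ℤ × ℤ => encodeNat (Encodable.encode AB)) '' {AB : ℤ × ℤ | IsInHeightFamily AB} ∈ BQP := by
  sorry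

/-- **S2 `stub_split`** (full rational `2`-torsion: `x³ + Ax + B` has three integer roots; GRH-free; L).
On the promise "`w = enc AB` with `AB` in the family", decide "three integer roots ∧ `#Sel₂(E_{A,B}) ≤ 2`"
(yes) against its negation within the family (no): integer roots in `P`; `S = {p ∣ 2Δ}` by Shor;
complete `2`-descent over `K_f = ℚ³` (`K_f(S,2) = ℚ(S,2)³`, Silverman AEC Prop. X.1.4), local images at
`v ∈ S ∪ {∞}` by bounded `p`-adic computation, `𝔽₂`-linear algebra; identification of the tree's
cohomological `WeierstrassCurve.selmerGroup _ 2` with the descent group (Cassels 1998 §2; Schaefer–Stoll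
2004).  [cite: SilvermanAEC2009, Prop. X.1.4] [cite: SchaeferStoll2003, §3] [cite: Shor1997, §5] -/
theorem stub_split :
    let P : ℤ × ℤ → Prop := fun AB => Nat.card ((shortWeierstrass AB).selmerGroup 2) ≤ 2
    let enc : ℤ × ℤ → List Bool := fun AB => encodeNat (Encodable.encode AB)
    let C : ℤ × ℤ → Prop := fun AB =>
      ∃ r s : ℤ, r ≠ s ∧ r ^ 3 + AB.1 * r + AB.2 = 0 ∧ s ^ 3 + AB.1 * s + AB.2 = 0
    (⟨enc '' {AB | IsInHeightFamily AB ∧ C AB ∧ P AB},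
      enc '' {AB | IsInHeightFamily AB ∧ ¬ (C AB ∧ P AB)}⟩ : PromiseProblem) ∈ PromiseBQP := by
  sorry

/-- **S3 `stub_oneRoot`** (exactly one rational `2`-torsion point; plausibly GRH-free; XL).  On the
promise, decide "exactly one integer root ∧ `#Sel₂ ≤ 2`" against its negation within the family:
`K_f = ℚ × F`, `F = ℚ(√(−3r² − 4A))`; an `𝔽₂`-basis of `F(S,2)` from the relation lattice of the prime
ideals of `F` above `S` in `Cl(F)` (abelian HSP with GIVEN generators — imaginary `F`: unique reduced
forms; real `F`: Hallgren's period lattice), generators of the resulting principal ideals (Hallgren's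
PIP / reduction), `Cl_S(F)[2]` by genus theory plus square roots in `Cl(F)` (Lagarias 1980, given the
factorisation of `d` by Shor); then the descent of S2 (Cassels / Schaefer–Stoll / Simon).
[cite: Hallgren2007, §1 (Pell and principal ideal problem)] [cite: SchaeferStoll2003, §3]
[cite: Simon2002, §1] -/
theorem stub_oneRoot :
    let P : ℤ × ℤ → Prop := fun AB => Nat.card ((shortWeierstrass AB).selmerGroup 2) ≤ 2
    let enc : ℤ × ℤ → List Bool := fun AB => encodeNat (Encodable.encode AB)
    let C : ℤ × ℤ → Prop := fun AB =>
      (∃ r : ℤ, r ^ 3 + AB.1 * r + AB.2 = 0) ∧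
        ¬ ∃ r s : ℤ, r ≠ s ∧ r ^ 3 + AB.1 * r + AB.2 = 0 ∧ s ^ 3 + AB.1 * s + AB.2 = 0
    (⟨enc '' {AB | IsInHeightFamily AB ∧ C AB ∧ P AB},
      enc '' {AB | IsInHeightFamily AB ∧ ¬ (C AB ∧ P AB)}⟩ : PromiseProblem) ∈ PromiseBQP := by
  sorry

/-- **S4 `stub_irreducible`** (no rational `2`-torsion: `K_f` a cubic field; XL — OPEN as typed).  On the
promise, decide "no integer root ∧ `#Sel₂ ≤ 2`" against its negation within the family: `O_{K,S}^×/2` and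
`Cl_S(K)[2]` of the cubic field by Hallgren 2005 (constant degree) / Eisenträger–Hallgren–Kitaev–Song /
Biasse–Song, then the descent of S2.  The printed class-group algorithms certify a GENERATING SET of
`Cl(K)` only through Bach's bound (GRH); GRH-free generation of `Cl(K)[2]` for general cubic `K` is open —
this stub carries the open-grade content of the crux (under `GrandRiemannHypothesisGL` it is provable
from print); the crux idea `integers-not-primes` (Shor-sampled integral ideals equidistribute in `Cl(K)`,
Debaene arXiv:1611.10103 Cor. 1) is a GRH-free plan for it.
[cite: Hallgren2005, §1 (unit group, PIP and class group in constant degree)] [cite: SchaeferStoll2003, §3] -/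
theorem stub_irreducible :
    let P : ℤ × ℤ → Prop := fun AB => Nat.card ((shortWeierstrass AB).selmerGroup 2) ≤ 2
    let enc : ℤ × ℤ → List Bool := fun AB => encodeNat (Encodable.encode AB)
    let C : ℤ × ℤ → Prop := fun AB => ¬ ∃ r : ℤ, r ^ 3 + AB.1 * r + AB.2 = 0
    (⟨enc '' {AB | IsInHeightFamily AB ∧ C AB ∧ P AB},
      enc '' {AB | IsInHeightFamily AB ∧ ¬ (C AB ∧ P AB)}⟩ : PromiseProblem) ∈ PromiseBQP := by
  sorry

/-! ### Name-keyed aliases of the stub statements (hypotheses of the composition) -/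

namespace Registered

/-- Alias of S1's statement (byte-identical body). -/
abbrev stub_family : Prop :=
    (fun AB : ℤ × ℤ => encodeNat (Encodable.encode AB)) '' {AB : ℤ × ℤ | IsInHeightFamily AB} ∈ BQP

/-- Alias of S2's statement (byte-identical body). -/
abbrev stub_split : Prop :=
    let P : ℤ × ℤ → Prop := fun AB => Nat.card ((shortWeierstrass AB).selmerGroup 2) ≤ 2
    let enc : ℤ × ℤ → List Bool := fun AB => encodeNat (Encodable.encode AB)
    let C : ℤ × ℤ → Prop := fun AB =>
      ∃ r s : ℤ, r ≠ s ∧ r ^ 3 + AB.1 * r + AB.2 = 0 ∧ s ^ 3 + AB.1 * s + AB.2 = 0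
    (⟨enc '' {AB | IsInHeightFamily AB ∧ C AB ∧ P AB},
      enc '' {AB | IsInHeightFamily AB ∧ ¬ (C AB ∧ P AB)}⟩ : PromiseProblem) ∈ PromiseBQP

/-- Alias of S3's statement (byte-identical body). -/
abbrev stub_oneRoot : Prop :=
    let P : ℤ × ℤ → Prop := fun AB => Nat.card ((shortWeierstrass AB).selmerGroup 2) ≤ 2
    let enc : ℤ × ℤ → List Bool := fun AB => encodeNat (Encodable.encode AB)
    let C : ℤ × ℤ → Prop := fun AB =>
      (∃ r : ℤ, r ^ 3 + AB.1 * r + AB.2 = 0) ∧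
        ¬ ∃ r s : ℤ, r ≠ s ∧ r ^ 3 + AB.1 * r + AB.2 = 0 ∧ s ^ 3 + AB.1 * s + AB.2 = 0
    (⟨enc '' {AB | IsInHeightFamily AB ∧ C AB ∧ P AB},
      enc '' {AB | IsInHeightFamily AB ∧ ¬ (C AB ∧ P AB)}⟩ : PromiseProblem) ∈ PromiseBQP

/-- Alias of S4's statement (byte-identical body). -/
abbrev stub_irreducible : Prop :=
    let P : ℤ × ℤ → Prop := fun AB => Nat.card ((shortWeierstrass AB).selmerGroup 2) ≤ 2
    let enc : ℤ × ℤ → List Bool := fun AB => encodeNat (Encodable.encode AB)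
    let C : ℤ × ℤ → Prop := fun AB => ¬ ∃ r : ℤ, r ^ 3 + AB.1 * r + AB.2 = 0
    (⟨enc '' {AB | IsInHeightFamily AB ∧ C AB ∧ P AB},
      enc '' {AB | IsInHeightFamily AB ∧ ¬ (C AB ∧ P AB)}⟩ : PromiseProblem) ∈ PromiseBQP

end Registered

/-! ### Kernel-checked composition: the four stub statements give the crux BY NAME -/

/-- **COMPOSITION (real proof, no sorry).**  From the statements of S1–S4 — as hypotheses, keyed by the
registered stub names through the `Registered.*` aliases (definitionally the inlined stub signatures; the
`example` below checks that each stub theorem inhabits its alias) — the route decl `SelmerMemBQP` follows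
BY NAME: the tree's guarded-OR closure of `BQP` (`Theorems.ArithStatLadder.IqThreeMemBQP.stub_guardedOr`,
LANDED) with guard = the family language, the three `2`-torsion-case promise problems, and `E = ∅`; the two
covering obligations are pure logic (every family member falls in exactly one case; a guarded non-member is
a family member with `#Sel₂ > 2`, hence a no-instance of all three problems).
[cite: BennettBernsteinBrassardVazirani1997, Cor. 4.15] -/
theorem SelmerMemBQP_of (h₁ : Registered.stub_family) (h₂ : Registered.stub_split)
    (h₃ : Registered.stub_oneRoot) (h₄ : Registered.stub_irreducible) : SelmerMemBQP := by
  classical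
  -- zeta-reduce the `let`s of the hypotheses and of the crux
  dsimp only [Registered.stub_family, Registered.stub_split, Registered.stub_oneRoot,
    Registered.stub_irreducible] at h₁ h₂ h₃ h₄
  unfold SelmerMemBQP
  dsimp only
  refine Summit.QuantumAdvantage.QuantumAdvantage.Theorems.ArithStatLadder.IqThreeMemBQP.stub_guardedOr
    _ _ _ _ _ ∅ h₁ h₂ h₃ h₄ ?_ ?_
  · -- members: in the family, and a yes-instance of the problem of their `2`-torsion case
    intro w _ hw
    obtain ⟨AB, ⟨hfam, hP⟩, rfl⟩ := hw
    refine ⟨⟨AB, hfam, rfl⟩, ?_⟩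
    by_cases h3 : ∃ r s : ℤ, r ≠ s ∧ r ^ 3 + AB.1 * r + AB.2 = 0 ∧ s ^ 3 + AB.1 * s + AB.2 = 0
    · exact Or.inl ⟨AB, ⟨hfam, h3, hP⟩, rfl⟩
    · by_cases h1 : ∃ r : ℤ, r ^ 3 + AB.1 * r + AB.2 = 0
      · exact Or.inr (Or.inl ⟨AB, ⟨hfam, ⟨h1, h3⟩, hP⟩, rfl⟩)
      · exact Or.inr (Or.inr ⟨AB, ⟨hfam, h1, hP⟩, rfl⟩)
  · -- non-members: outside the family, or a no-instance of all three case problems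
    intro w _ hw
    by_cases hG : w ∈ (fun AB : ℤ × ℤ => encodeNat (Encodable.encode AB)) '' {AB : ℤ × ℤ | IsInHeightFamily AB}
    · obtain ⟨AB, hfam, rfl⟩ := hG
      have hnP : ¬ Nat.card ((shortWeierstrass AB).selmerGroup 2) ≤ 2 := fun hP => hw ⟨AB, ⟨hfam, hP⟩, rfl⟩
      exact Or.inr ⟨⟨AB, ⟨hfam, fun h => hnP h.2⟩, rfl⟩, ⟨AB, ⟨hfam, fun h => hnP h.2⟩, rfl⟩,
        ⟨AB, ⟨hfam, fun h => hnP h.2⟩, rfl⟩⟩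
    · exact Or.inl hG

/-- Consistency check only (an `example`, so nothing sorry-tainted concluding the crux enters the
environment): the composition typechecks against the four stubs exactly as stated. -/
example : SelmerMemBQP := SelmerMemBQP_of stub_family stub_split stub_oneRoot stub_irreducible

end Summit.QuantumAdvantage.QuantumAdvantage.Cruxes.SelmerMemBQP.Birth

end
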